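import Summits.AnomalousDissipation.AnomalousDissipation.Theorems.BaireTransferDenseLoudDesignerForcesErgodicModelDefs
import Summits.AnomalousDissipation.AnomalousDissipation.Theorems.BaireTransferDenseLoudDesignerForcesErgodicFramePreimage
import Summits.AnomalousDissipation.AnomalousDissipation.Theorems.BaireTransferDenseLoudDesignerForcesErgodicPhaseInjOn
import Summits.AnomalousDissipation.AnomalousDissipation.Theorems.BaireTransferDenseLoudDesignerForcesErgodicH2Smoothing

/-!
# Dynamics of the model on the core preimage (registered tools stub S6d₁ of the crux `DenseLoudDesignerForces`,
# line ergodic-budget-selection-closing, block N)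

Summit-side plumbing for the fields `mapsTo`, `surjOn`, `injOn` of `IsHyperbolicSemiflowModel`: for an NS phase `(K, φ)`,
a model frame `F`, a strongly invariant `Kc ⊆ K` (`φ t '' Kc = Kc`) and any family `g` conjugate to the phase on
`Λ := F.S ⁻¹' Kc` (`F.S (g t y) = φ t (F.S y)`), each `g t` (`t ≥ 0`) maps `Λ` into itself, onto itself (core states are
smooth honest fields, hence in the range of `F.S` by `stub_framePreimageTools`), and injectively (`stub_phaseInjOnTools` and
injectivity of `F.S`).
-/

set_option linter.dupNamespace false

noncomputable section

open Filter Set Function MeasureTheory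
open scoped InnerProductSpace RealInnerProductSpace Topology

namespace Summit.AnomalousDissipation.AnomalousDissipation.Theorems.DenseLoudDesignerForces.Ergodic

open Literature.Analysis.FunctionSpaces Literature.Analysis.FunctionSpaces.Torus
open Literature.Analysis.FluidPDE Literature.Analysis.FluidPDE.Torus
open Summit.AnomalousDissipation.AnomalousDissipation.Theses.BaireTransfer
open Summit.AnomalousDissipation.AnomalousDissipation.Theorems.DenseLoudDesignerForces.Negative

/-- A state represented a.e. by a smooth divergence-free field IS the state of that field. [folklore] -/
theorem eq_stateOf_of_rep_ae_eq (x : Hsp) {v : (UnitAddTorus (Fin 3)) → (EuclideanSpace ℝ (Fin 3))} (hv : IsSmooth v)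
    (hd : IsDivFree v) (h : rep x =ᵐ[volume] v) : x = stateOf v := by
  have hm : HasZeroMean v := hasZeroMean_of_rep_ae_eq x h
  exact Subtype.ext (Lp.ext (h.trans (rep_stateOf hv hd hm).symm))

/-- **Core states are smooth honest fields**: if `φ t '' Kc = Kc ⊆ K` for `t ≥ 0`, every `x ∈ Kc` is `stateOf v` for a smooth
divergence-free mean-zero `v` (namely the time-`1` slice of the trajectory of a preimage under `φ 1`). [folklore] -/
theorem exists_eq_stateOf_of_mem_core {ν : ℝ} {F₀ : (UnitAddTorus (Fin 3)) → (EuclideanSpace ℝ (Fin 3))} {K : Set Hsp}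
    {φ : ℝ → Hsp → Hsp} (hK : IsNSPhase ν F₀ K φ) {Kc : Set Hsp} (hKcK : Kc ⊆ K)
    (hinv : ∀ t : ℝ, 0 ≤ t → φ t '' Kc = Kc) {x : Hsp} (hx : x ∈ Kc) :
    ∃ v : (UnitAddTorus (Fin 3)) → (EuclideanSpace ℝ (Fin 3)), IsSmooth v ∧ IsDivFree v ∧ HasZeroMean v ∧ x = stateOf v := by
  have hx1 : x ∈ φ 1 '' Kc := by rw [hinv 1 zero_le_one]; exact hx
  obtain ⟨x', hx', rfl⟩ := hx1
  obtain ⟨u, p, hsol, hrep⟩ := hK.trajectory x' (hKcK hx')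
  have h1 : rep (φ 1 x') =ᵐ[volume] u 1 := hrep 1 zero_le_one
  have hsm : IsSmooth (u 1) := hsol.smooth_velocity.isSmooth_slice (mem_Ici.2 zero_le_one)
  have hdf : IsDivFree (u 1) := hsol.divFree 1 (mem_Ici.2 zero_le_one)
  exact ⟨u 1, hsm, hdf, hasZeroMean_of_rep_ae_eq _ h1, eq_stateOf_of_rep_ae_eq _ hsm hdf h1⟩

/-- **Dynamics of the model on the core preimage** (registered tools stub S6d₁): `MapsTo`, `SurjOn`, `InjOn` of each `g t`, `t ≥ 0`, on
`F.S ⁻¹' Kc`, from the conjugacy `F.S (g t y) = φ t (F.S y)`, the strong invariance `φ t '' Kc = Kc`, the range statement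
`stub_framePreimageTools` and the injectivity of `φ t` on `K` (`stub_phaseInjOnTools`) and of `F.S`. [folklore] -/
theorem stub_modelCoreDynamicsTools {S : Finset (Fin 3 → ℤ)} {c : ↥S → (EuclideanSpace ℂ (Fin 3))} {ν : ℝ} {K : Set Hsp}
    {φ : ℝ → Hsp → Hsp} (hν : 0 < ν) (hK : IsNSPhase ν (force S c) K φ) (F : ModelFrame) {Kc : Set Hsp} (hKcK : Kc ⊆ K)
    (hinv : ∀ t : ℝ, 0 ≤ t → φ t '' Kc = Kc) {g : ℝ → Hsp → Hsp}
    (hconj : ∀ t : ℝ, 0 ≤ t → ∀ y : Hsp, F.S y ∈ Kc → F.S (g t y) = φ t (F.S y)) :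
    ∀ t : ℝ, 0 ≤ t → MapsTo (g t) (F.S ⁻¹' Kc) (F.S ⁻¹' Kc) ∧ SurjOn (g t) (F.S ⁻¹' Kc) (F.S ⁻¹' Kc) ∧ InjOn (g t) (F.S ⁻¹' Kc) := by
  intro t ht
  refine ⟨fun y hy => ?_, fun z hz => ?_, fun y₁ hy₁ y₂ hy₂ heq => ?_⟩
  · -- mapsTo: `F.S (g t y) = φ t (F.S y) ∈ φ t '' Kc = Kc`
    show F.S (g t y) ∈ Kc
    rw [hconj t ht y hy, ← hinv t ht]
    exact mem_image_of_mem _ hy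
  · -- surjOn: `F.S z ∈ Kc = φ t '' Kc`, the preimage point is a smooth state, hence `F.S y'`
    have hz' : F.S z ∈ φ t '' Kc := by rw [hinv t ht]; exact hz
    obtain ⟨x', hx', hx'z⟩ := hz'
    obtain ⟨v, hv, hd, hm, hx'v⟩ := exists_eq_stateOf_of_mem_core hK hKcK hinv hx'
    set y' : Hsp := F.S (stateOf v - stateOf (laplacian v)) with hy'
    have hSy' : F.S y' = x' := by rw [hy', stub_framePreimageTools F.ι F.b F.m F.hmodes F.S F.hS hv hd hm, hx'v]
    have hy'Λ : y' ∈ F.S ⁻¹' Kc := by show F.S y' ∈ Kc; rw [hSy']; exact hx'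
    refine ⟨y', hy'Λ, F.hSinj ?_⟩
    rw [hconj t ht y' hy'Λ, hSy', hx'z]
  · -- injOn: `φ t (F.S y₁) = φ t (F.S y₂)` with `F.S yᵢ ∈ Kc ⊆ K`
    have h1 : φ t (F.S y₁) = φ t (F.S y₂) := by rw [← hconj t ht y₁ hy₁, ← hconj t ht y₂ hy₂, heq]
    exact F.hSinj (stub_phaseInjOnTools hν hK t ht (hKcK hy₁) (hKcK hy₂) h1)

end Summit.AnomalousDissipation.AnomalousDissipation.Theorems.DenseLoudDesignerForces.Ergodic

end
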